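import Summits.BirchSwinnertonDyer.BirchSwinnertonDyer.Theorems.CMKolyvaginAtInertTwoCMKolyvaginConjectureAtInertTwoFirstDescentDepthBound
import Literature.NumberTheory.EllipticCurves.HeegnerPointsOfConductorOneData
import HarnessLib

/-!
# Route `CMKolyvaginAtInertTwo`, crux `CMKolyvaginConjectureAtInertTwo` (stmt-BirchSwinnertonDyer-24648),
# stub `stub_positiveDepth` — THE STRICT-DESCENT OBSTRUCTION CLASS AT A KOLYVAGIN PRIME, AT `p = 2` ON H₂

Seat `leafhand-bsd-cmkolyvaginatinert-5` g0 (cell `bsd-eis`); helper `--supports stmt-BirchSwinnertonDyer-24648`.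
THEOREMS ONLY: no definition, no named fact, no `sorry`.  BSD is NOT proved by any of this; the stub and the crux
stay OPEN.  Conditional (like the route's lower-bound engine) on Gross 1991 Prop. 3.7 (2) BY NAME
(`GrossLMS1991.prop37_2_reductionCongruence_inert N_E W K`, item 28665).

WHAT.  File `…FirstDescentDepthBound` proved the non-strict half of Kolyvagin's first descent at `2` on H₂
(`m(ℓ) ≤ m(1) = M₀` at deep CM-inert Kolyvagin primes).  What the stub needs beyond it is the STRICT step
`m(ℓ) < M₀` (and its iteration).  This file isolates the strict step as the non-vanishing of ONE explicit Selmer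
class — McCallum's `d = p^{m(1)−…}·c(ℓ)` of §5 at `p = 2`:  for a frame with `2^{M₀} ∣ y_K`, `L ≥ M₀`, a prime `ℓ`
that is Zhang–Kolyvagin at `2` of index `≥ L`, and ANY datum `e` of conductor `ℓ`, the class
`s_ℓ := 2^{L−M₀}·c_L(ℓ) ∈ H¹(K, E[2^L])`
* lies in the `2^L`-Selmer group of `E/K` (`…mem_selmerGroup`; uses the habitat's ODD TAMAGAWA PRODUCT, McCallum Lemma 4.3
  / Gross Prop. 6.2, through the route's `KolyvaginLowerTwo.zsmul_kolyvaginClass_two_mem_selmerGroup_of_forall`),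
* is locally trivial at the place `λ ∣ ℓ` (`…mem_torsionLocalKer`, Kolyvagin's relation, intrinsic form),
* is killed by `2^{M₀}`, is a `τ`-eigenclass of sign `−w(E)·(−1)` (`conjAct_obstructionClass`),
* and VANISHES IFF `2^{M₀} ∣ P(ℓ)` in `E(K[ℓ])` (`…eq_zero_iff`).
Hence at the deep primes of `exists_deep_cmInert_prime_depth_le` (where `2^{M₀+1} ∤ P(ℓ)`): **the strict descent
`m(ℓ) < m(1)` holds iff `s_ℓ ≠ 0`** (`exists_deep_cmInert_prime_strictDescent_iff`).  The level-`1` input is the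
rigidity `P_e(1) = P_{d₁}(1)` for all conductor-`1` data (`derivedPoint_eq_of_conductor_one`, Gross §4: `S = 𝒢_1`).

HONEST RESIDUAL.  Proving `s_ℓ ≠ 0` for some `ℓ` when `M₀ ≥ 1` — Kolyvagin's pairing of `s_ℓ` against `Ш(E/K)[2^∞]`
(McCallum Lemma 5.3 / Prop. 5.2; at `2` the `τ`-eigen step degenerates) — is the research content of 28177 / 24648.

References: [McCallumLMS1991] §4 Lemma 4.3, Prop. 4.4, Cor. 4.5, §5 (the class `d`, Lemma 5.3, Prop. 5.2);
[Kolyvagin1991MathAnn] Thm. 2.2; [GrossLMS1991] §4 (P_1), Prop. 3.7 (2), Prop. 5.3, Prop. 6.2.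
-/

set_option autoImplicit false
-- the Theorems namespace of this sub repeats the summit name by design (D-0017 nested layout)
set_option linter.dupNamespace false

noncomputable section

open scoped Classical

open Field NumberField IsDedekindDomain Function WeierstrassCurve Rat.HeightOneSpectrum
open Literature.NumberTheory.EllipticCurves
open Literature.NumberTheory.EllipticCurves.ModularForms
open Literature.NumberTheory.GaloisRepresentations
open Literature.NumberTheory.GaloisCohomology
open Literature.NumberTheory.EllipticCurves.GrossLMS1991 (prop37_2_reductionCongruence_inert)
open Summit.BirchSwinnertonDyer.Rank1Residual (X11b.KolyvaginAssembly.discr_lt_neg_four)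
open Summit.BirchSwinnertonDyer.BirchSwinnertonDyer.Theorems.GenusExact

namespace Summit.BirchSwinnertonDyer.BirchSwinnertonDyer.Theorems.CMKolyvaginFirstDescentTwo

variable (W : WeierstrassCurve ℚ) [W.IsElliptic] [W.IsGloballyMinimal] [NeZero (W.conductorNorm ℤ)]
  {K : Type} [Field K] [NumberField K]

/-! ## §1 Conductor `1` is rigid: every datum has the same derived point `y_K` -/

omit [W.IsElliptic] [W.IsGloballyMinimal] in
/-- **`P_e(1) = P_d(1)` for any two conductor-`1` data** (Gross 1991, §4: at `n = 1` the transversal is all of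
`𝒢_1` — the tree's `KolyvaginHeegnerData.mem_S_iff` — and `y(1)` is pinned by `map_y`; so `P(1) = Tr_{K[1]/K} y(1)`
does not depend on the datum). [cite: GrossLMS1991, §4 (P_1 = Tr y_1 = y_K)] -/
theorem derivedPoint_eq_of_conductor_one {Dt : ModularParametrizationData W (W.conductorNorm ℤ)} {β : ℤ}
    {ι : K →+* ℂ} (d e : KolyvaginHeegnerData Dt β ι 1) : e.derivedPoint = d.derivedPoint := by
  have hy : e.y = d.y :=
    Affine.Point.map_injective (W' := W) (f := (ringClassField K ι 1).subtype.toRatAlgHom)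
      (by rw [e.map_y, d.map_y])
  have hS : e.S = d.S := by
    ext g
    rw [e.mem_S_iff, d.mem_S_iff]
  rw [e.derivedPoint_one, d.derivedPoint_one, hy, hS]

/-- **`2^{L−M₀}·c_L(e) = 0` for every conductor-`1` datum `e` once `2^{M₀} ∣ y_K`** (`M₀ ≤ L`; `K` imaginary
quadratic with odd `d_K ≠ −3`, Heegner, `ρ̄_{E,2}` onto — for the admissibility of `E(K[1]) ⊆ E(K̄)` at `2`).
[cite: McCallumLMS1991, §4 Cor. 4.5] [cite: GrossLMS1991, §4, Lemma 4.3] -/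
theorem zsmul_kolyvaginClass_eq_zero_of_conductor_one (hρ2 : W.HasSurjectiveModNGaloisRep 2)
    (hK : IsImaginaryQuadratic K) (hodd : Odd (NumberField.discr K)) (h3 : NumberField.discr K ≠ -3)
    (hHe : SatisfiesHeegnerHypothesis (W.conductorNorm ℤ) K)
    {Dt : ModularParametrizationData W (W.conductorNorm ℤ)} {β : ℤ} {ι : K →+* ℂ}
    (d₁ : KolyvaginHeegnerData Dt β ι 1) {M₀ L : ℕ} (hML : M₀ ≤ L)
    (hdiv : ∃ Q : (W.baseChange (ringClassField K ι 1)).toAffine.Point,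
      ((2 ^ M₀ : ℕ) : ℤ) • Q = d₁.derivedPoint)
    (e : KolyvaginHeegnerData Dt β ι 1) :
    ((2 ^ (L - M₀) : ℕ) : ℤ) • e.kolyvaginClass Nat.prime_two L = 0 := by
  have h4 : NumberField.discr K ≠ -4 := fun h ↦ by
    rw [h] at hodd
    exact (Int.not_even_iff_odd.mpr hodd) ⟨-2, by norm_num⟩
  have hD : NumberField.discr K < -4 := X11b.KolyvaginAssembly.discr_lt_neg_four hK ⟨h3, h4⟩
  have hsurj1 : W.HasSurjectiveModNGaloisRep ((2 : ℤ) ^ 1) := by simpa using hρ2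
  have hND : IsCoprime ((W.conductorNorm ℤ : ℕ) : ℤ) (NumberField.discr K) :=
    GenusKoly.heegner_isCoprime_conductorNorm_discr hK hHe
  have hkol1 : ∀ q ∈ (1 : ℕ).primeFactors,
      Zhang2014.IsKolyvaginPrime (W.conductorNorm ℤ) W K 2 q ∧ L ≤ Zhang2014.kolyvaginIndex W 2 q := by
    intro q hq
    simp at hq
  let data₁ : (m : ℕ) → m ∣ 1 → KolyvaginHeegnerData Dt β ι m := fun m hm ↦ (Nat.dvd_one.mp hm).symm ▸ e
  have hdata₁ : data₁ 1 dvd_rfl = e := rfl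
  have hA : KolyvaginCocycle.IsAdmissible (absoluteGaloisGroup K) e.pointsSubgroup ((2 ^ L : ℕ) : ℤ) :=
    GenusKoly.isAdmissible_pointsSubgroup_two hK hodd hHe hsurj1 one_ne_zero e L
  have hP : e.toGeomPoints e.derivedPoint ∈
      KolyvaginCocycle.invPoints (absoluteGaloisGroup K) e.pointsSubgroup ((2 ^ L : ℕ) : ℤ) := by
    have h := Rank1Residual.X11b.Three.KolyCert.toGeomPoints_derivedPoint_mem_invPoints_of_dvd_zhang hK ι Dt
      Nat.prime_two hND hD squarefree_one hkol1 data₁ 1 dvd_rfl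
    rwa [hdata₁] at h
  obtain ⟨Q, hQ⟩ := hdiv
  rw [Rank1Residual.JET.zsmul_kolyvaginClass_eq_zero_iff e Nat.prime_two L hA hP]
  refine ⟨Q, ?_⟩
  rw [derivedPoint_eq_of_conductor_one W d₁ e, ← hQ, smul_smul, ← Nat.cast_mul, ← pow_add, Nat.sub_add_cancel hML]

omit [W.IsElliptic] [W.IsGloballyMinimal] in
/-- Transport of the previous statement to any conductor `a = 1` (the quotient `ℓ / ℓ` of the intrinsic Selmer
lemma is such an `a`). [folklore] -/
theorem forall_zsmul_kolyvaginClass_eq_zero_of_eq_one {Dt : ModularParametrizationData W (W.conductorNorm ℤ)}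
    {β : ℤ} {ι : K →+* ℂ} {L : ℕ} {k : ℤ}
    (h1 : ∀ e : KolyvaginHeegnerData Dt β ι 1, k • e.kolyvaginClass Nat.prime_two L = 0)
    {a : ℕ} (ha : a = 1) (e : KolyvaginHeegnerData Dt β ι a) : k • e.kolyvaginClass Nat.prime_two L = 0 := by
  subst ha
  exact h1 e

/-! ## §2 The obstruction class `s_ℓ = 2^{L−M₀}·c_L(ℓ)` -/

/-- **The class `s_ℓ = 2^{L−M₀}·c_L(ℓ)` is a `2^L`-Selmer class of `E/K`, locally trivial at `λ ∣ ℓ`, killed by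
`2^{M₀}`.**  H₂-type frame: `W` globally minimal with `ρ̄_{E,2}` onto and ODD Tamagawa product, `K` imaginary
quadratic with odd `d_K ≠ −3` and the Heegner hypothesis, Gross 1991 Prop. 3.7 (2) at `(W, K)` by name; a
conductor-`1` datum `d₁` with `2^{M₀} ∣ y_K`, `M₀ ≤ L`; `ℓ` a Zhang–Kolyvagin prime at `2` of index `≥ L`; `e` ANY
datum of conductor `ℓ`.  (McCallum 1991 §5, the class `d`, via Lemma 4.3 / Prop. 4.4 at `2` = the route's intrinsic
`KolyvaginLowerTwo.zsmul_kolyvaginClass_two_mem_selmerGroup_of_forall` and `…_mem_torsionLocalKer_of_forall`.)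
[cite: McCallumLMS1991, §4 Lemma 4.3, Prop. 4.4; §5 (p. 285)] [cite: GrossLMS1991, Prop. 3.7 (2), Prop. 6.2] -/
theorem obstructionClass_mem_selmerGroup (hρ2 : W.HasSurjectiveModNGaloisRep 2) (hT : Odd W.tamagawaProduct)
    (hK : IsImaginaryQuadratic K) (hodd : Odd (NumberField.discr K)) (h3 : NumberField.discr K ≠ -3)
    (hHe : SatisfiesHeegnerHypothesis (W.conductorNorm ℤ) K)
    (h37 : prop37_2_reductionCongruence_inert (W.conductorNorm ℤ) W K)
    (Dt : ModularParametrizationData W (W.conductorNorm ℤ)) (β : ℤ) (ι : K →+* ℂ)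
    (d₁ : KolyvaginHeegnerData Dt β ι 1) {M₀ L : ℕ} (hML : M₀ ≤ L)
    (hdiv : ∃ Q : (W.baseChange (ringClassField K ι 1)).toAffine.Point,
      ((2 ^ M₀ : ℕ) : ℤ) • Q = d₁.derivedPoint)
    {ℓ : ℕ} (hKol : Zhang2014.IsKolyvaginPrime (W.conductorNorm ℤ) W K 2 ℓ)
    (hidx : L ≤ Zhang2014.kolyvaginIndex W 2 ℓ) (e : KolyvaginHeegnerData Dt β ι ℓ) :
    ((2 ^ (L - M₀) : ℕ) : ℤ) • e.kolyvaginClass Nat.prime_two L ∈ selmerGroup (W.baseChange K) ((2 ^ L : ℕ) : ℤ) ∧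
      (∀ v : HeightOneSpectrum (𝓞 K), (ℓ : 𝓞 K) ∈ v.asIdeal →
        ((2 ^ (L - M₀) : ℕ) : ℤ) • e.kolyvaginClass Nat.prime_two L ∈
          (W.baseChange K).torsionLocalKer (v.adicCompletion K) ((2 ^ L : ℕ) : ℤ)) ∧
      ((2 ^ M₀ : ℕ) : ℤ) • (((2 ^ (L - M₀) : ℕ) : ℤ) • e.kolyvaginClass Nat.prime_two L) = 0 := by
  have h4 : NumberField.discr K ≠ -4 := fun h ↦ by
    rw [h] at hodd
    exact (Int.not_even_iff_odd.mpr hodd) ⟨-2, by norm_num⟩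
  have hℓp : ℓ.Prime := hKol.1
  have hℓsq : Squarefree ℓ := hℓp.squarefree
  have hkolℓ : ∀ q ∈ ℓ.primeFactors,
      Zhang2014.IsKolyvaginPrime (W.conductorNorm ℤ) W K 2 q ∧ L ≤ Zhang2014.kolyvaginIndex W 2 q := by
    intro q hq
    rw [hℓp.primeFactors, Finset.mem_singleton] at hq
    subst hq
    exact ⟨hKol, hidx⟩
  have h1 : ∀ e₁ : KolyvaginHeegnerData Dt β ι 1,
      ((2 ^ (L - M₀) : ℕ) : ℤ) • e₁.kolyvaginClass Nat.prime_two L = 0 :=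
    fun e₁ ↦ zsmul_kolyvaginClass_eq_zero_of_conductor_one W hρ2 hK hodd h3 hHe d₁ hML hdiv e₁
  have hsub : ∀ q ∈ ℓ.primeFactors, ∀ e' : KolyvaginHeegnerData Dt β ι (ℓ / q),
      ((2 ^ (L - M₀) : ℕ) : ℤ) • e'.kolyvaginClass Nat.prime_two L = 0 := by
    intro q hq e'
    rw [hℓp.primeFactors, Finset.mem_singleton] at hq
    subst hq
    exact forall_zsmul_kolyvaginClass_eq_zero_of_eq_one W h1 (Nat.div_self hℓp.pos) e'
  have hℓmem : ℓ ∈ ℓ.primeFactors := by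
    rw [hℓp.primeFactors, Finset.mem_singleton]
  refine ⟨KolyvaginLowerTwo.zsmul_kolyvaginClass_two_mem_selmerGroup_of_forall W Dt β ι hρ2 hK h3 h4 hHe hT h37 L
      (L - M₀) hℓsq hkolℓ e hsub, fun v hv ↦ ?_, ?_⟩
  · exact KolyvaginLowerTwo.zsmul_kolyvaginClass_two_mem_torsionLocalKer_of_forall W Dt β ι hρ2 hK h3 h4 hHe h37 L
      (L - M₀) hℓsq hkolℓ e hsub hℓmem v hv
  · rw [smul_smul, ← Nat.cast_mul, ← pow_add, Nat.add_sub_cancel' hML]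
    exact zsmul_discreteH1_torsion _ _

/-- **`s_ℓ = 0` iff `2^{M₀} ∣ P(ℓ)` in `E(K[ℓ])`** (same frame; `E(K[ℓ])` has no `2`-power torsion, so
`2^L ∣ 2^{L−M₀}·P(ℓ) ⟺ 2^{M₀} ∣ P(ℓ)`; McCallum Cor. 4.5 at `2` with both cocycle inputs discharged on the frame).
[cite: McCallumLMS1991, §4 Cor. 4.5, §5] [cite: GrossLMS1991, Prop. 3.6, Lemma 4.3] -/
theorem obstructionClass_eq_zero_iff (hρ2 : W.HasSurjectiveModNGaloisRep 2)
    (hK : IsImaginaryQuadratic K) (hodd : Odd (NumberField.discr K)) (h3 : NumberField.discr K ≠ -3)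
    (hHe : SatisfiesHeegnerHypothesis (W.conductorNorm ℤ) K)
    (Dt : ModularParametrizationData W (W.conductorNorm ℤ)) (β : ℤ) (ι : K →+* ℂ)
    (d₁ : KolyvaginHeegnerData Dt β ι 1) {M₀ L : ℕ} (hML : M₀ ≤ L)
    {ℓ : ℕ} (hKol : Zhang2014.IsKolyvaginPrime (W.conductorNorm ℤ) W K 2 ℓ)
    (hidx : L ≤ Zhang2014.kolyvaginIndex W 2 ℓ) (e : KolyvaginHeegnerData Dt β ι ℓ) :
    ((2 ^ (L - M₀) : ℕ) : ℤ) • e.kolyvaginClass Nat.prime_two L = 0 ↔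
      ∃ Q : (W.baseChange (ringClassField K ι ℓ)).toAffine.Point, ((2 ^ M₀ : ℕ) : ℤ) • Q = e.derivedPoint := by
  have h4 : NumberField.discr K ≠ -4 := fun h ↦ by
    rw [h] at hodd
    exact (Int.not_even_iff_odd.mpr hodd) ⟨-2, by norm_num⟩
  have hD : NumberField.discr K < -4 := X11b.KolyvaginAssembly.discr_lt_neg_four hK ⟨h3, h4⟩
  have hsurj1 : W.HasSurjectiveModNGaloisRep ((2 : ℤ) ^ 1) := by simpa using hρ2
  have hND : IsCoprime ((W.conductorNorm ℤ : ℕ) : ℤ) (NumberField.discr K) :=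
    GenusKoly.heegner_isCoprime_conductorNorm_discr hK hHe
  have hℓp : ℓ.Prime := hKol.1
  have hkolℓ : ∀ q ∈ ℓ.primeFactors,
      Zhang2014.IsKolyvaginPrime (W.conductorNorm ℤ) W K 2 q ∧ L ≤ Zhang2014.kolyvaginIndex W 2 q := by
    intro q hq
    rw [hℓp.primeFactors, Finset.mem_singleton] at hq
    subst hq
    exact ⟨hKol, hidx⟩
  -- data at the divisors `1, ℓ` of `ℓ`, with top member `e`
  let data : (m : ℕ) → m ∣ ℓ → KolyvaginHeegnerData Dt β ι m := fun m hm ↦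
    if h : m = ℓ then h ▸ e else (((Nat.dvd_prime hℓp).mp hm).resolve_right h).symm ▸ d₁
  have hdata : data ℓ dvd_rfl = e := by simp [data]
  have hA : KolyvaginCocycle.IsAdmissible (absoluteGaloisGroup K) e.pointsSubgroup ((2 ^ L : ℕ) : ℤ) :=
    GenusKoly.isAdmissible_pointsSubgroup_two hK hodd hHe hsurj1 hℓp.ne_zero e L
  have hP : e.toGeomPoints e.derivedPoint ∈
      KolyvaginCocycle.invPoints (absoluteGaloisGroup K) e.pointsSubgroup ((2 ^ L : ℕ) : ℤ) := by
    have h := Rank1Residual.X11b.Three.KolyCert.toGeomPoints_derivedPoint_mem_invPoints_of_dvd_zhang hK ι Dt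
      Nat.prime_two hND hD hℓp.squarefree hkolℓ data ℓ dvd_rfl
    rwa [hdata] at h
  rw [Rank1Residual.JET.zsmul_kolyvaginClass_eq_zero_iff e Nat.prime_two L hA hP]
  have hpow : ((2 ^ L : ℕ) : ℤ) = ((2 ^ (L - M₀) : ℕ) : ℤ) * ((2 ^ M₀ : ℕ) : ℤ) := by
    rw [← Nat.cast_mul, ← pow_add, Nat.sub_add_cancel hML]
  constructor
  · rintro ⟨Q, hQ⟩
    refine ⟨Q, ?_⟩
    -- `2^{L−M₀}·(2^{M₀}·Q − P) = 0` in the `2`-power-torsion-free group `E(K[ℓ])`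
    have h0 : ((2 ^ (L - M₀) : ℕ) : ℤ) • (((2 ^ M₀ : ℕ) : ℤ) • Q - e.derivedPoint) = 0 := by
      rw [smul_sub, smul_smul, ← hpow, hQ, sub_self]
    have := GenusKoly.heegner_two_pow_torsion_free (ι := ι) hK hodd hHe hsurj1 hℓp.ne_zero (L - M₀) _ h0
    exact sub_eq_zero.mp this
  · rintro ⟨Q, hQ⟩
    exact ⟨Q, by rw [hpow, mul_smul, hQ]⟩

/-- **`s_ℓ` is a `τ`-eigenclass of sign `−w(E)·(−1)`** (Gross Prop. 5.3 / McCallum §5 at `2`: `τ c_L(ℓ) = −ε(−1)^{1} c_L(ℓ)`,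
the tree's `KolyvaginClassSign.sign_conjAct_kolyvaginClass_two`, pushed through the scalar `2^{L−M₀}`).
[cite: GrossLMS1991, Prop. 5.3, Prop. 5.4] [cite: McCallumLMS1991, §5 (p. 303)] -/
theorem conjAct_obstructionClass (hρ2 : W.HasSurjectiveModNGaloisRep 2)
    (hK : IsImaginaryQuadratic K) (hodd : Odd (NumberField.discr K)) (h3 : NumberField.discr K ≠ -3)
    (hHe : SatisfiesHeegnerHypothesis (W.conductorNorm ℤ) K) (τ : K ≃ₐ[ℚ] K) (hτ : τ ≠ 1)
    (Dt : ModularParametrizationData W (W.conductorNorm ℤ)) (β : ℤ) (ι : K →+* ℂ) {M₀ L : ℕ} (hL : 1 ≤ L)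
    {ℓ : ℕ} (hKol : Zhang2014.IsKolyvaginPrime (W.conductorNorm ℤ) W K 2 ℓ)
    (hidx : L ≤ Zhang2014.kolyvaginIndex W 2 ℓ) (e : KolyvaginHeegnerData Dt β ι ℓ) :
    (-W.rootNumber * (-1) ^ 1 = 1 ∨ -W.rootNumber * (-1) ^ 1 = -1) ∧
      conjAct W τ ((2 ^ L : ℕ) : ℤ) (((2 ^ (L - M₀) : ℕ) : ℤ) • e.kolyvaginClass Nat.prime_two L) =
        (-W.rootNumber * (-1) ^ 1) • (((2 ^ (L - M₀) : ℕ) : ℤ) • e.kolyvaginClass Nat.prime_two L) := by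
  have h4 : NumberField.discr K ≠ -4 := fun h ↦ by
    rw [h] at hodd
    exact (Int.not_even_iff_odd.mpr hodd) ⟨-2, by norm_num⟩
  have hsurj1 : W.HasSurjectiveModNGaloisRep ((2 : ℤ) ^ 1) := by simpa using hρ2
  have hℓp : ℓ.Prime := hKol.1
  have hkolℓ : ∀ q ∈ ℓ.primeFactors,
      Zhang2014.IsKolyvaginPrime (W.conductorNorm ℤ) W K 2 q ∧ L ≤ Zhang2014.kolyvaginIndex W 2 q := by
    intro q hq
    rw [hℓp.primeFactors, Finset.mem_singleton] at hq
    subst hq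
    exact ⟨hKol, hidx⟩
  obtain ⟨hsgn, hτe⟩ := KolyvaginClassSign.sign_conjAct_kolyvaginClass_two hK h3 h4 hodd hHe hsurj1 τ hτ Dt β ι
    hℓp.squarefree hL hkolℓ e
  rw [hℓp.primeFactors, Finset.card_singleton] at hsgn hτe
  refine ⟨hsgn, ?_⟩
  rw [map_zsmul, hτe, smul_comm]

/-! ## §3 At the deep primes of the first descent: strict descent ⟺ `s_ℓ ≠ 0` -/

/-- **STRICT DESCENT ⟺ NON-VANISHING OF THE OBSTRUCTION CLASS.**  On an H₂ frame (`W` globally minimal with CM,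
`2` inert in the CM field, `ρ̄_{E,2}` onto, ODD Tamagawa product; `K` imaginary quadratic, odd `d_K ≠ −3`, Heegner;
Gross 1991 Prop. 3.7 (2) at `(W, K)` by name) with a conductor-`1` datum of exact depth `M₀`, for every `L ≥ M₀ + 1`
and finite `S` there are a prime `ℓ ∉ S` (Zhang–Kolyvagin at `2`, index `≥ L`, `Frob_ℓ = Frob_∞` on `K(E[2^L])`,
`CMInert W ℓ`) and a datum `e` of conductor `ℓ` such that: `2^{M₀+1} ∤ P(ℓ)` (file `…FirstDescentDepthBound`);
`s_ℓ = 2^{L−M₀}·c_L(e)` is a `2^L`-Selmer class of `E/K`, locally trivial at `λ ∣ ℓ`, killed by `2^{M₀}`; and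
**`2^{M₀} ∤ P(ℓ)` (the strict descent `m(ℓ) < m(1)`) iff `s_ℓ ≠ 0`.**  McCallum 1991 §5 at `p = 2` on the
CM-inert habitat; what remains for the stub is the non-vanishing of such an `s_ℓ` (Kolyvagin's pairing argument).
[cite: McCallumLMS1991, §5 (the class d; Lemma 5.3, Prop. 5.2)] [cite: Kolyvagin1991MathAnn, Thm. 2.2]
[cite: GrossLMS1991, Prop. 3.7 (2), Prop. 6.2] -/
theorem exists_deep_cmInert_prime_strictDescent_iff (hCM : W.HasCM) (hin : Rank1Residual.CMInert W 2)
    (hρ2 : W.HasSurjectiveModNGaloisRep 2) (hT : Odd W.tamagawaProduct)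
    (hK : IsImaginaryQuadratic K) (hodd : Odd (NumberField.discr K)) (h3 : NumberField.discr K ≠ -3)
    (hHe : SatisfiesHeegnerHypothesis (W.conductorNorm ℤ) K)
    (h37 : prop37_2_reductionCongruence_inert (W.conductorNorm ℤ) W K)
    (Dt : ModularParametrizationData W (W.conductorNorm ℤ)) (β : ℤ) (ι : K →+* ℂ)
    (d₁ : KolyvaginHeegnerData Dt β ι 1) {M₀ : ℕ}
    (hdiv : ∃ Q : (W.baseChange (ringClassField K ι 1)).toAffine.Point,
      ((2 ^ M₀ : ℕ) : ℤ) • Q = d₁.derivedPoint)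
    (hndiv : ¬ ∃ Q : (W.baseChange (ringClassField K ι 1)).toAffine.Point,
      ((2 ^ (M₀ + 1) : ℕ) : ℤ) • Q = d₁.derivedPoint)
    {L : ℕ} (hL : M₀ + 1 ≤ L) (S : Finset ℕ) :
    ∃ (ℓ : ℕ) (e : KolyvaginHeegnerData Dt β ι ℓ), ℓ.Prime ∧ ℓ ∉ S ∧
      Zhang2014.IsKolyvaginPrime (W.conductorNorm ℤ) W K 2 ℓ ∧ L ≤ Zhang2014.kolyvaginIndex W 2 ℓ ∧
      FrobEqFrobInfty W K (2 ^ L) ℓ ∧ Rank1Residual.CMInert W ℓ ∧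
      (¬ ∃ Q : (W.baseChange (ringClassField K ι ℓ)).toAffine.Point,
        ((2 ^ (M₀ + 1) : ℕ) : ℤ) • Q = e.derivedPoint) ∧
      ((2 ^ (L - M₀) : ℕ) : ℤ) • e.kolyvaginClass Nat.prime_two L ∈ selmerGroup (W.baseChange K) ((2 ^ L : ℕ) : ℤ) ∧
      (∀ v : HeightOneSpectrum (𝓞 K), (ℓ : 𝓞 K) ∈ v.asIdeal →
        ((2 ^ (L - M₀) : ℕ) : ℤ) • e.kolyvaginClass Nat.prime_two L ∈
          (W.baseChange K).torsionLocalKer (v.adicCompletion K) ((2 ^ L : ℕ) : ℤ)) ∧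
      ((2 ^ M₀ : ℕ) : ℤ) • (((2 ^ (L - M₀) : ℕ) : ℤ) • e.kolyvaginClass Nat.prime_two L) = 0 ∧
      ((¬ ∃ Q : (W.baseChange (ringClassField K ι ℓ)).toAffine.Point, ((2 ^ M₀ : ℕ) : ℤ) • Q = e.derivedPoint) ↔
        ((2 ^ (L - M₀) : ℕ) : ℤ) • e.kolyvaginClass Nat.prime_two L ≠ 0) := by
  have hML : M₀ ≤ L := by omega
  obtain ⟨ℓ, e, hℓp, hℓS, hKol, hidx, hFrob, hF, he⟩ :=
    exists_deep_cmInert_prime_depth_le W hCM hin hρ2 hK hodd h3 hHe h37 Dt β ι d₁ hdiv hndiv hL S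
  obtain ⟨hSel, hloc, hkill⟩ :=
    obstructionClass_mem_selmerGroup W hρ2 hT hK hodd h3 hHe h37 Dt β ι d₁ hML hdiv hKol hidx e
  have hiff := obstructionClass_eq_zero_iff W hρ2 hK hodd h3 hHe Dt β ι d₁ hML hKol hidx e
  exact ⟨ℓ, e, hℓp, hℓS, hKol, hidx, hFrob, hF, he, hSel, hloc, hkill, (not_congr hiff).symm⟩

end Summit.BirchSwinnertonDyer.BirchSwinnertonDyer.Theorems.CMKolyvaginFirstDescentTwo

end
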